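import Summits.QuantumFields.BalabanUV.T4Continuum.Spine.NE1p.B7AveragingAbelianSector
import Literature.MathematicalPhysics.QuantumFieldTheory.Balaban1983to89.B7Eq136Series

/-!
# T⁴ programme, spine estimate NE1′ (node O3b/H2) — THE ABELIAN SECTOR OF PROPOSITION 4's EXPANSION (134)–(136) AT THE FLAT
# BACKGROUND: the one-step map (121) is its linear part (122) EXACTLY, the composite (127) is the composite of the linear parts,
# the remainder `C_j(1, ·)` of (150) VANISHES on abelian fields, and so does EVERY homogeneous term `C_j⁽ⁿ⁾(1, ·)` of (136)

Cell `pub-balaban-gaps` (YM blitz Y1, track G2), seat `ne1` gen 8 (prover-pub-balaban-gaps-ne1-g8-0); record `HOME/ne/NE1.md` v8 §4 R49 ∕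
R50.  ADDITIVE — imports this seat's `B7AveragingAbelianSector` (file 1 of gen 8: `Ū_c(e^{A}) = exp T_c(A)` in the abelian sector) and the
p06 ∕ r04 ∕ leaf-10 lineages' `B7Eq136Series` (through it `B7Eq136SecondOrder` `CCovIter2`, `B7Prop5GeneralInduction` `CCovIter` (150),
`B7Prop4GeneralLevels` `logCovIter`∕`linCovIter` (127), `B7Prop3GeneralLinear` `Qcov`∕`linQcov`∕`Ccov` (121)–(122), `B7Prop4Flat` `logIter`,
`B7Prop3Flat` `Favg`∕`vframe`∕`dbavg`∕`Fhat`∕`linQ`∕`frame_cancellation` (89)∕(110)∕(120)∕(122)∕(124), `B7Eq92Concrete.avgIter_one`) ONLY;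
every declaration consumed BY NAME, nothing edited or restated; NO new definition.

PRINT.  [Balaban1985Averaging] = T. Bałaban, *Averaging operations for lattice gauge theories*, CMP **98** (1985) 17–51: (121)–(122) p. 36
«Q(V₀, A, c) = L(Q(V₀)A)_c + C(V₀, A, c)» («C(V₀, A, c) is an analytic function of A whose Taylor's expansion begins with a second-order
polynomial»); (127) p. 37 and p. 38 «Q_{j+1}(U₀, ηA) = Q(Ū₀ʲ, Q_j(U₀, ηA)), Q_{j+1}(U₀) = Q(Ū₀ʲ)Q_j(U₀)»; Proposition 4 (134)–(135) pp. 38–39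
«Q_k(U₀, ηA) = Q_k(U₀)A + C_k(U₀, A), |C_k(U₀, A)| ≦ C₂|A|²»; (136) p. 39 «C_k(U₀, A) = C_k^{(2)}(U₀, A) + C_k^{(3)}(U₀, A) + …»; (150) p. 40.
NE1.md R46 (a) cites (134)–(136) p. 38–39 as the printed locus of the NONLINEAR part of the composed averaging; gen 7 read its size
structurally («a single-bond perturbation of a flat background stays in a one-parameter subgroup through the whole composition, so its coarse
image is EXACTLY linear — the diagonal curvature vanishes»).  THIS FILE makes that reading a kernel statement about the printed objects
(121)∕(122)∕(127)∕(134)∕(136)∕(150) AS TYPED IN THE TREE, at the flat background `U₀ = 1`.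

WHAT THIS FILE PROVES ([folklore] Banach-algebra bookkeeping; abelian sector = bond field with pairwise commuting values, `hA`∕`hB`).
* §1 the block frames (110) are exponentials of the linearised frames, `v(y) = exp F̂(y)` (`Favg_expCfg`, `val_vframe_expCfg`), and with
  file 1's `Ū_c = exp T_c` and the frame cancellation (124) `−F̂(c₋) + T_c + F̂(c₊) = L(Q₀A)_c` the double-bar average (89)∕(120) is
  **`V̿₁(c) = exp(L·(Q₀A)_c)`** (`val_dbavg_expCfg`): hence **the one-step map (121) IS its linear part (122)**, `Q(1, A, c) = L(Q(1)A)_c`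
  (`Qcov_one_expCfg`; `linQcov_one_of_commute` — the derivative form, no sup bound needed), i.e. **`C(1, A, c) = 0`** (`Ccov_one_of_commute`).
* §2 the linear part preserves the abelian sector, so at `U₀ = 1` the composite of the linear parts `linCovIter L 1 B j` («Q_j(1)») stays
  abelian with the sup bound `Lʲ·sup‖B‖` (`commute_linCovIter_one`, `norm_linCovIter_one_le`, `linCovIter_one_succ_of_commute`).
* §3 **THE COMPOSITE (127) IS THE COMPOSITE OF THE LINEAR PARTS**: for an abelian `B` with `2(d+1)·Lʲ·sup‖B‖ < ln 2` (all loops, tree legs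
  and images of all levels `< j` inside the logarithm radius), `logIter L B j = linCovIter L 1 B j` (`logIter_eq_linCovIter_one`), so
  **the remainder (150)∕(134) vanishes: `C_j(1, B)(c) = 0`** (`CCovIter_one_eq_zero`) at every bond `c` of level `j`.
* §4 along the abelian ray `t ↦ tB` the remainder is identically `0` near `t = 0` (`eventually_CCovIter_one_smul_eq_zero`), hence **EVERY
  HOMOGENEOUS TERM OF (136) VANISHES**: `C_j⁽²⁾(1, B)(c) = 0` (`CCovIter2_one_eq_zero` — NO DIAGONAL CURVATURE of the composed averaging),
  `C_j⁽ⁿ⁾(1, B)(c) = 0` for all `n` (`CCovIterN_one_eq_zero`).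
CONSEQUENCE FOR THE ROW (NE1.md v8 R49∕R50).  R46 (a)'s structural reading is now kernel for the PRINTED expansion (134)–(136) with its
contour system (flat background): the curvature of the `j`-fold composed averaging in the direction of an abelian (one-parameter) slot is
ZERO at every level — the `L⁻¹` letter of the curvature channel (R48) rests on the cross-bond commutator terms alone, which gen 7's
`TiltedMeanSmoothDualSymmetry.integral_comm_eq_zero` centres at a flat exterior modulo (α).  What remains READING: a non-flat background `U₀`
(there a one-parameter `A` no longer gives commuting factors — the background interleaves), and the instantiation on the RG densities.
Classification of NE1′ UNCHANGED: WORK-bound ∕ OBJECT-bound ∕ NOT idea-bound.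

HONEST FRAMING.  [folklore] identities over an ABSTRACT complete normed `ℂ`-algebra and the b07 lineage's `ℤᵈ` model; nothing of Bałaban's
is asserted beyond the SHAPE of (89)∕(110)∕(120)–(122)∕(127)∕(134)∕(136)∕(150) as typed by the lineages named above; no density, R-operation,
slot or background of his run is constructed; NE1′ NOT proved; spine 0∕9; (B) 0∕13; binders 0∕6; one fixed finite T⁴ — NOT ℝ⁴, NOT infinite
volume, NOT a mass gap, NOT Clay.  0 sorry.
-/

noncomputable section

open scoped BigOperators Topology
open NormedSpace Finset Filter

namespace Summit.QuantumFields.BalabanUV.T4Continuum.NE1p.B7AveragingAbelianSector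

open Literature.MathematicalPhysics.QuantumFieldTheory.Balaban1983to89.B7Prop1Explicit
open Literature.MathematicalPhysics.QuantumFieldTheory.Balaban1983to89.B7Prop3Flat (expCfg asum_csmul Favg vframe dbavg Fhat
  linQ frame_cancellation linQ_csmul norm_linQ_le)
open Literature.MathematicalPhysics.QuantumFieldTheory.Balaban1983to89.B7Prop4Flat (logIter logIter_succ logIter_zero)
open Literature.MathematicalPhysics.QuantumFieldTheory.Balaban1983to89.B7Prop5Flat (bump norm_bump_le)
open Literature.MathematicalPhysics.QuantumFieldTheory.Balaban1983to89.B7Prop4GeneralLevels (logCovIter linCovIter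
  logCovIter_one_left linCovIter_succ linCovIter_zero)
open Literature.MathematicalPhysics.QuantumFieldTheory.Balaban1983to89.B7Prop3GeneralLinear (Qcov linQcov Ccov Qcov_one_left)
open Literature.MathematicalPhysics.QuantumFieldTheory.Balaban1983to89.B7Prop5GeneralInduction (CCovIter)
open Literature.MathematicalPhysics.QuantumFieldTheory.Balaban1983to89.B7Eq136SecondOrder (CCovIter2 CCovIter2_def)
open Literature.MathematicalPhysics.QuantumFieldTheory.Balaban1983to89.B7Eq136Series (CCovIterN CCovIterN_def)
open Literature.MathematicalPhysics.QuantumFieldTheory.Balaban1983to89.B7Eq92Concrete (avgIter_one)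
open Literature.MathematicalPhysics.QuantumFieldTheory.Balaban1983to89.B7BlockAvgLog (mlog_exp)
open Literature.MathematicalPhysics.QuantumFieldTheory.Balaban1983to89.MatrixLog (mlog)
open Literature.Analysis.Complex (mem_eball_expSeries_radius)

variable {d : ℕ} {𝔸 : Type*} [NormedRing 𝔸] [NormedAlgebra ℂ 𝔸] [CompleteSpace 𝔸]
variable {A : Site d → Fin d → 𝔸} {L : ℕ}

/-! ## §1 The block frames and the double-bar average (89)∕(110)∕(120) in an abelian sector; the one-step map (121) -/

/-- **The frame exponent (110) is its linearisation (112), exactly**: `F(y) = F̂(y)` when the tree sums lie inside the logarithm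
radius (abelian sector). [cite: Balaban1985Averaging, (110)–(112) p.34] -/
theorem Favg_expCfg (hA : ∀ x κ y μ, Commute (A x κ) (A y μ)) (q : Site d)
    (hF : ∀ r : Fin d → Fin L, ‖asum A q (treeWord (boxVec L r))‖ < Real.log 2) :
    Favg L (expCfg A) q = Fhat L A q := by
  unfold Favg Fhat
  exact Finset.sum_congr rfl fun r _ => by rw [val_hol_expCfg hA, mlog_exp (hF r)]

/-- The block frame (110)∕(82) of an abelian configuration: `v(y) = exp F̂(y)`. [cite: Balaban1985Averaging, (110) p.34, (82) p.30] -/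
theorem val_vframe_expCfg (hA : ∀ x κ y μ, Commute (A x κ) (A y μ)) (q : Site d)
    (hF : ∀ r : Fin d → Fin L, ‖asum A q (treeWord (boxVec L r))‖ < Real.log 2) :
    ((vframe L (expCfg A) q : 𝔸ˣ) : 𝔸) = exp (Fhat L A q) := by
  show ((expUnit (Favg L (expCfg A) q) : 𝔸ˣ) : 𝔸) = _
  rw [val_expUnit, Favg_expCfg hA q hF]

/-- … and its inverse `v(y)⁻¹ = exp(−F̂(y))`. [cite: Balaban1985Averaging, (110) p.34] -/
theorem val_vframe_inv_expCfg (hA : ∀ x κ y μ, Commute (A x κ) (A y μ)) (q : Site d)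
    (hF : ∀ r : Fin d → Fin L, ‖asum A q (treeWord (boxVec L r))‖ < Real.log 2) :
    (((vframe L (expCfg A) q)⁻¹ : 𝔸ˣ) : 𝔸) = exp (-Fhat L A q) :=
  units_val_inv_eq_exp_neg (val_vframe_expCfg hA q hF)

omit [CompleteSpace 𝔸] in
/-- An element commuting with every path sum commutes with `F̂(y)`. [folklore] -/
theorem commute_Fhat_of {X : 𝔸} (h : ∀ (x : Site d) (w : List (Letter d)), Commute X (asum A x w)) (L : ℕ) (q : Site d) :
    Commute X (Fhat L A q) := by
  unfold Fhat
  exact Commute.sum_right _ _ _ fun r _ => (h _ _).smul_right _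

omit [CompleteSpace 𝔸] in
/-- An element commuting with every path sum commutes with `T_c`. [folklore] -/
theorem commute_Tside_of {X : 𝔸} (h : ∀ (x : Site d) (w : List (Letter d)), Commute X (asum A x w)) (L : ℕ) (q : Site d)
    (κ : Fin d) : Commute X (Tside L A q κ) := by
  unfold Tside
  exact Commute.sum_right _ _ _ fun r _ => (h _ _).smul_right _

omit [CompleteSpace 𝔸] in
/-- An element commuting with every path sum commutes with `L(Q₀A)_c`. [folklore] -/
theorem commute_linQ_of {X : 𝔸} (h : ∀ (x : Site d) (w : List (Letter d)), Commute X (asum A x w)) (L : ℕ) (q : Site d)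
    (κ : Fin d) : Commute X (linQ L A q κ) := by
  unfold linQ
  exact Commute.sum_right _ _ _ fun r _ => (h _ _).smul_right _

omit [CompleteSpace 𝔸] in
/-- In an abelian sector `F̂(y)` commutes with every path sum. [folklore] -/
theorem commute_Fhat_asum (hA : ∀ x κ y μ, Commute (A x κ) (A y μ)) (L : ℕ) (q : Site d) (x : Site d) (w : List (Letter d)) :
    Commute (Fhat L A q) (asum A x w) :=
  (commute_Fhat_of (fun x' w' => commute_asum_asum hA w x x' w') L q).symm

omit [CompleteSpace 𝔸] in
/-- In an abelian sector `L(Q₀A)_c` commutes with every path sum. [folklore] -/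
theorem commute_linQ_asum (hA : ∀ x κ y μ, Commute (A x κ) (A y μ)) (L : ℕ) (q : Site d) (κ : Fin d) (x : Site d)
    (w : List (Letter d)) : Commute (linQ L A q κ) (asum A x w) :=
  (commute_linQ_of (fun x' w' => commute_asum_asum hA w x x' w') L q κ).symm

/-- **THE DOUBLE-BAR AVERAGE (89)∕(120) OF AN ABELIAN CONFIGURATION IS `exp(L·(Q₀A)_c)`**: `V̿₁(c) = v(c₋)⁻¹·V̄₁(c)·v(c₊) =
exp(−F̂(c₋))·exp(T_c)·exp(F̂(c₊)) = exp(−F̂(c₋) + T_c + F̂(c₊)) = exp(L(Q₀A)_c)` — the frame cancellation (124) INSIDE the exponential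
(all loop sums and tree sums at the bond inside the logarithm radius). [cite: Balaban1985Averaging, (89) p.31, (120) p.35, (124)–(125) p.36] -/
theorem val_dbavg_expCfg (hA : ∀ x κ y μ, Commute (A x κ) (A y μ)) (hL : 1 ≤ L) (q : Site d) (κ : Fin d)
    (hγ : ∀ r : Fin d → Fin L, ‖asum A q (gammaWord L κ (boxVec L r) ++ seg κ (-(L : ℤ)))‖ < Real.log 2)
    (hF₁ : ∀ r : Fin d → Fin L, ‖asum A q (treeWord (boxVec L r))‖ < Real.log 2)
    (hF₂ : ∀ r : Fin d → Fin L, ‖asum A (q + (L : ℤ) • e κ) (treeWord (boxVec L r))‖ < Real.log 2) :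
    ((dbavg L (expCfg A) q κ : 𝔸ˣ) : 𝔸) = exp (linQ L A q κ) := by
  show ((((vframe L (expCfg A) q)⁻¹ * bavg L (expCfg A) q κ * vframe L (expCfg A) (q + (L : ℤ) • e κ) : 𝔸ˣ)) : 𝔸) = _
  have c1 : Commute (-Fhat L A q) (Tside L A q κ) :=
    (commute_Tside_of (fun x w => commute_Fhat_asum hA L q x w) L q κ).neg_left
  have c2 : Commute (-Fhat L A q + Tside L A q κ) (Fhat L A (q + (L : ℤ) • e κ)) :=
    Commute.add_left (commute_Fhat_of (fun x w => commute_Fhat_asum hA L q x w) L _).neg_left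
      (commute_Fhat_of (fun x w => (commute_Tside_of (fun x' w' => commute_asum_asum hA w x x' w') L q κ).symm) L _)
  rw [Units.val_mul, Units.val_mul, val_vframe_inv_expCfg hA q hF₁, val_bavg_expCfg hA hL q κ hγ,
    val_vframe_expCfg hA _ hF₂,
    ← exp_add_of_commute_of_mem_ball c1 (mem_eball_expSeries_radius _) (mem_eball_expSeries_radius _),
    ← exp_add_of_commute_of_mem_ball c2 (mem_eball_expSeries_radius _) (mem_eball_expSeries_radius _),
    frame_cancellation]

/-- **THE ONE-STEP MAP (121) IS ITS LINEAR PART (122), EXACTLY, IN AN ABELIAN SECTOR**: `Q(1, A, c) = (1/i) log V̿₁(c) = L(Q(1)A)_c`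
(the image `L(Q₀A)_c` also inside the radius). [cite: Balaban1985Averaging, (121)–(122) p.36, (125) p.36] -/
theorem Qcov_one_expCfg (hA : ∀ x κ y μ, Commute (A x κ) (A y μ)) (hL : 1 ≤ L) (q : Site d) (κ : Fin d)
    (hγ : ∀ r : Fin d → Fin L, ‖asum A q (gammaWord L κ (boxVec L r) ++ seg κ (-(L : ℤ)))‖ < Real.log 2)
    (hF₁ : ∀ r : Fin d → Fin L, ‖asum A q (treeWord (boxVec L r))‖ < Real.log 2)
    (hF₂ : ∀ r : Fin d → Fin L, ‖asum A (q + (L : ℤ) • e κ) (treeWord (boxVec L r))‖ < Real.log 2)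
    (hQ : ‖linQ L A q κ‖ < Real.log 2) :
    Qcov L (1 : Site d → Fin d → 𝔸ˣ) A q κ = linQ L A q κ := by
  rw [Qcov_one_left, val_dbavg_expCfg hA hL q κ hγ hF₁ hF₂, mlog_exp hQ]

omit [CompleteSpace 𝔸] in
/-- Along the ray `tA` all the (finitely many) smallness conditions at one `L`-bond hold for `t` near `0`. [folklore] -/
theorem eventually_oneStep_small (A : Site d → Fin d → 𝔸) (L : ℕ) (q : Site d) (κ : Fin d) :
    ∀ᶠ t : ℂ in 𝓝 0,
      (∀ r : Fin d → Fin L, ‖asum (t • A) q (gammaWord L κ (boxVec L r) ++ seg κ (-(L : ℤ)))‖ < Real.log 2) ∧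
      (∀ r : Fin d → Fin L, ‖asum (t • A) q (treeWord (boxVec L r))‖ < Real.log 2) ∧
      (∀ r : Fin d → Fin L, ‖asum (t • A) (q + (L : ℤ) • e κ) (treeWord (boxVec L r))‖ < Real.log 2) ∧
      ‖linQ L (t • A) q κ‖ < Real.log 2 := by
  have h2 : (0 : ℝ) < Real.log 2 := Real.log_pos one_lt_two
  have key : ∀ X : 𝔸, ∀ᶠ t : ℂ in 𝓝 0, ‖t • X‖ < Real.log 2 := fun X => by
    have hc : Continuous fun t : ℂ => ‖t • X‖ := (continuous_id.smul continuous_const).norm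
    exact (isOpen_lt hc continuous_const).mem_nhds (by simpa using h2)
  refine ((Filter.eventually_all.2 fun r => ?_).and ((Filter.eventually_all.2 fun r => ?_).and
    ((Filter.eventually_all.2 fun r => ?_).and ?_)))
  · simpa only [asum_csmul] using key (asum A q (gammaWord L κ (boxVec L r) ++ seg κ (-(L : ℤ))))
  · simpa only [asum_csmul] using key (asum A q (treeWord (boxVec L r)))
  · simpa only [asum_csmul] using key (asum A (q + (L : ℤ) • e κ) (treeWord (boxVec L r)))
  · simpa only [linQ_csmul] using key (linQ L A q κ)

/-- `Q(1, tA, c) = t·L(Q₀A)_c` for `t` near `0` (abelian sector): the one-step map is LINEAR along abelian rays. [cite: Balaban1985Averaging, (121)–(122) p.36] -/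
theorem eventuallyEq_Qcov_one_smul (hA : ∀ x κ y μ, Commute (A x κ) (A y μ)) (hL : 1 ≤ L) (q : Site d) (κ : Fin d) :
    (fun t : ℂ => Qcov L (1 : Site d → Fin d → 𝔸ˣ) (t • A) q κ) =ᶠ[𝓝 0] fun t => t • linQ L A q κ :=
  (eventually_oneStep_small A L q κ).mono fun t ht => by
    show Qcov L (1 : Site d → Fin d → 𝔸ˣ) (t • A) q κ = t • linQ L A q κ
    rw [Qcov_one_expCfg (commute_smul hA t) hL q κ ht.1 ht.2.1 ht.2.2.1 ht.2.2.2, linQ_csmul]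

/-- **The linear part (122) «L(Q(1)A)_c» (typed as the `t`-derivative at `0`) IS `L(Q₀A)_c` in an abelian sector** — no sup bound on `A`
needed (only the finitely many paths at the bond enter). [cite: Balaban1985Averaging, (122) p.36, (125) p.36] -/
theorem linQcov_one_of_commute (hA : ∀ x κ y μ, Commute (A x κ) (A y μ)) (hL : 1 ≤ L) (q : Site d) (κ : Fin d) :
    linQcov L (1 : Site d → Fin d → 𝔸ˣ) A q κ = linQ L A q κ := by
  show deriv (fun t : ℂ => Qcov L (1 : Site d → Fin d → 𝔸ˣ) (t • A) q κ) 0 = _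
  rw [(eventuallyEq_Qcov_one_smul hA hL q κ).deriv_eq]
  simpa using deriv_smul_const (f := linQ L A q κ) differentiableAt_id (x := (0 : ℂ))

/-- **`C(1, A, c) = 0`: THE ONE-STEP REMAINDER OF (122) VANISHES IN AN ABELIAN SECTOR** (all smallness conditions at the bond).
[cite: Balaban1985Averaging, (122)–(123) p.36] -/
theorem Ccov_one_of_commute (hA : ∀ x κ y μ, Commute (A x κ) (A y μ)) (hL : 1 ≤ L) (q : Site d) (κ : Fin d)
    (hγ : ∀ r : Fin d → Fin L, ‖asum A q (gammaWord L κ (boxVec L r) ++ seg κ (-(L : ℤ)))‖ < Real.log 2)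
    (hF₁ : ∀ r : Fin d → Fin L, ‖asum A q (treeWord (boxVec L r))‖ < Real.log 2)
    (hF₂ : ∀ r : Fin d → Fin L, ‖asum A (q + (L : ℤ) • e κ) (treeWord (boxVec L r))‖ < Real.log 2)
    (hQ : ‖linQ L A q κ‖ < Real.log 2) :
    Ccov L (1 : Site d → Fin d → 𝔸ˣ) A q κ = 0 := by
  show Qcov L (1 : Site d → Fin d → 𝔸ˣ) A q κ - linQcov L (1 : Site d → Fin d → 𝔸ˣ) A q κ = 0
  rw [Qcov_one_expCfg hA hL q κ hγ hF₁ hF₂ hQ, linQcov_one_of_commute hA hL, sub_self]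

/-! ## §2 The composite of the linear parts at `U₀ = 1` stays abelian; sup bounds level by level -/

omit [CompleteSpace 𝔸] in
/-- In an abelian sector the values `L(Q₀A)_c`, `L(Q₀A)_{c′}` commute. [folklore] -/
theorem commute_linQ_linQ (hA : ∀ x κ y μ, Commute (A x κ) (A y μ)) (L : ℕ) (q : Site d) (κ : Fin d) (q' : Site d)
    (κ' : Fin d) : Commute (linQ L A q κ) (linQ L A q' κ') :=
  commute_linQ_of (fun x w => commute_linQ_asum hA L q κ x w) L q' κ'

/-- **«Q_{j+1}(1) = Q(1)Q_j(1)» with the flat linear part**: for an abelian `B`, every composite `linCovIter L 1 B j` is abelian and the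
recursion reads `linCovIter L 1 B (j+1) (z, κ) = L(Q₀(linCovIter L 1 B j))_{⟨Lz, Lz+Le_κ⟩}`. [cite: Balaban1985Averaging, p.38 (before (133)), (122) p.36] -/
theorem commute_linCovIter_one {B : Site d → Fin d → 𝔸} (hB : ∀ x κ y μ, Commute (B x κ) (B y μ)) (hL : 1 ≤ L) :
    ∀ (j : ℕ) (x : Site d) (κ : Fin d) (y : Site d) (μ : Fin d),
      Commute (linCovIter L (1 : Site d → Fin d → 𝔸ˣ) B j x κ) (linCovIter L (1 : Site d → Fin d → 𝔸ˣ) B j y μ)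
  | 0 => by simpa using hB
  | j + 1 => by
    intro x κ y μ
    rw [linCovIter_succ, linCovIter_succ, avgIter_one, linQcov_one_of_commute (commute_linCovIter_one hB hL j) hL,
      linQcov_one_of_commute (commute_linCovIter_one hB hL j) hL]
    exact commute_linQ_linQ (commute_linCovIter_one hB hL j) L _ _ _ _

/-- the recursion of the flat linear composites in closed form (abelian sector). [cite: Balaban1985Averaging, p.38 (before (133))] -/
theorem linCovIter_one_succ_of_commute {B : Site d → Fin d → 𝔸} (hB : ∀ x κ y μ, Commute (B x κ) (B y μ)) (hL : 1 ≤ L)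
    (j : ℕ) (z : Site d) (κ : Fin d) :
    linCovIter L (1 : Site d → Fin d → 𝔸ˣ) B (j + 1) z κ
      = linQ L (linCovIter L (1 : Site d → Fin d → 𝔸ˣ) B j) ((L : ℤ) • z) κ := by
  rw [linCovIter_succ, avgIter_one, linQcov_one_of_commute (commute_linCovIter_one hB hL j) hL]

omit [CompleteSpace 𝔸] in
/-- sup bound of the flat linear part: `‖L(Q₀A)_c‖ ≤ L·sup‖A‖` (`B7Prop3Flat.norm_linQ_le` with a global bound). [cite: Balaban1985Averaging, (126) p.36] -/
theorem norm_linQ_le_of_norm_le (hL : 1 ≤ L) {a : ℝ} (ha : 0 ≤ a) (hA : ∀ x κ, ‖A x κ‖ ≤ a) (q : Site d) (κ : Fin d) :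
    ‖linQ L A q κ‖ ≤ L * a :=
  norm_linQ_le A q (d * L + L) ha (fun x κ _ => hA x κ) L hL q κ (by simp [l1])

omit [NormedAlgebra ℂ 𝔸] [CompleteSpace 𝔸] in
/-- tree sums: `‖A(Γ_{y,x})‖ ≤ dL·sup‖A‖` (`|x − y|₁ ≤ dL` in a block). [cite: Balaban1985Averaging, (14) p.19] -/
theorem norm_asum_treeWord_le {a : ℝ} (ha : 0 ≤ a) (hA : ∀ x κ, ‖A x κ‖ ≤ a) (q : Site d) (r : Fin d → Fin L) :
    ‖asum A q (treeWord (boxVec L r))‖ ≤ (d * L : ℕ) * a := by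
  have h := norm_asum_le A q (d * L) ha (fun x κ _ => hA x κ) (treeWord (boxVec L r)) q
    (by simpa [l1, length_treeWord] using l1_boxVec_le L r)
  refine h.trans ?_
  gcongr
  rw [length_treeWord]
  exact l1_boxVec_le L r

/-- sup bounds of the flat linear composites: `‖linCovIter L 1 B j‖ ≤ Lʲ·sup‖B‖` (abelian sector). [cite: Balaban1985Averaging, (126) p.36, p.38 (before (133))] -/
theorem norm_linCovIter_one_le {B : Site d → Fin d → 𝔸} (hB : ∀ x κ y μ, Commute (B x κ) (B y μ)) (hL : 1 ≤ L) {M : ℝ}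
    (hM0 : 0 ≤ M) (hM : ∀ x κ, ‖B x κ‖ ≤ M) :
    ∀ (j : ℕ) (x : Site d) (κ : Fin d), ‖linCovIter L (1 : Site d → Fin d → 𝔸ˣ) B j x κ‖ ≤ (L : ℝ) ^ j * M
  | 0 => by simpa using hM
  | j + 1 => by
    intro x κ
    rw [linCovIter_one_succ_of_commute hB hL]
    calc _ ≤ (L : ℝ) * ((L : ℝ) ^ j * M) :=
          norm_linQ_le_of_norm_le hL (by positivity) (norm_linCovIter_one_le hB hL hM0 hM j) _ _
      _ = (L : ℝ) ^ (j + 1) * M := by ring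

/-! ## §3 The composite (127) at `U₀ = 1` is the composite of the linear parts; the remainder (150)∕(134) vanishes -/

/-- one level of smallness from the sup bound: if `2(d+1)L·a < ln 2` and `sup‖X‖ ≤ a` then all loop sums, tree sums and images
`L(Q₀X)_c` of the abelian field `X` are inside the logarithm radius, so `(1/i) log V̿₁ = L(Q₀X)` bondwise. [folklore] -/
theorem mlog_dbavg_expCfg_of_norm_le {X : Site d → Fin d → 𝔸} (hX : ∀ x κ y μ, Commute (X x κ) (X y μ)) (hL : 1 ≤ L)
    {a : ℝ} (ha : 0 ≤ a) (hXa : ∀ x κ, ‖X x κ‖ ≤ a) (hrad : (2 * ((d : ℝ) + 1) * L) * a < Real.log 2)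
    (q : Site d) (κ : Fin d) :
    mlog ((dbavg L (expCfg X) q κ : 𝔸ˣ) : 𝔸) = linQ L X q κ := by
  have hdL : ((d * L : ℕ) : ℝ) * a ≤ (2 * ((d : ℝ) + 1) * L) * a := by
    apply mul_le_mul_of_nonneg_right _ ha
    push_cast; nlinarith [(Nat.cast_nonneg d : (0 : ℝ) ≤ d), (Nat.cast_nonneg L : (0 : ℝ) ≤ L)]
  have hLa : (L : ℝ) * a ≤ (2 * ((d : ℝ) + 1) * L) * a := by
    apply mul_le_mul_of_nonneg_right _ ha
    nlinarith [(Nat.cast_nonneg d : (0 : ℝ) ≤ d), (Nat.cast_nonneg L : (0 : ℝ) ≤ L)]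
  rw [← Qcov_one_left]
  exact Qcov_one_expCfg hX hL q κ (fun r => loops_small_of_norm_le ha hXa hrad q κ r)
    (fun r => ((norm_asum_treeWord_le ha hXa q r).trans hdL).trans_lt hrad)
    (fun r => ((norm_asum_treeWord_le ha hXa _ r).trans hdL).trans_lt hrad)
    (((norm_linQ_le_of_norm_le hL ha hXa q κ).trans hLa).trans_lt hrad)

/-- **THE COMPOSITE (127) OF THE ONE-STEP MAPS AT THE FLAT BACKGROUND IS THE COMPOSITE OF THEIR LINEAR PARTS**: for an abelian `B`
with `2(d+1)·Lʲ·sup‖B‖ < ln 2`, `Q_j(1, B) = linCovIter L 1 B j` («Lʲη·Q_j(1)B») as configurations. [cite: Balaban1985Averaging, (127) p.37, p.38 (before (133)), (134) p.38] -/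
theorem logIter_eq_linCovIter_one {B : Site d → Fin d → 𝔸} (hB : ∀ x κ y μ, Commute (B x κ) (B y μ)) (hL : 1 ≤ L) {M : ℝ}
    (hM0 : 0 ≤ M) (hM : ∀ x κ, ‖B x κ‖ ≤ M) :
    ∀ j : ℕ, 2 * ((d : ℝ) + 1) * (L : ℝ) ^ j * M < Real.log 2 →
      logIter L B j = linCovIter L (1 : Site d → Fin d → 𝔸ˣ) B j
  | 0, _ => by simp
  | j + 1, hrad => by
    have hL1 : (1 : ℝ) ≤ L := by exact_mod_cast hL
    have hrad' : 2 * ((d : ℝ) + 1) * (L : ℝ) ^ j * M < Real.log 2 := by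
      refine lt_of_le_of_lt ?_ hrad
      have : (L : ℝ) ^ j ≤ (L : ℝ) ^ (j + 1) := pow_le_pow_right₀ hL1 (Nat.le_succ j)
      have hd : (0 : ℝ) ≤ 2 * ((d : ℝ) + 1) := by positivity
      nlinarith [mul_le_mul_of_nonneg_left this hd]
    have hradj : (2 * ((d : ℝ) + 1) * L) * ((L : ℝ) ^ j * M) < Real.log 2 := by
      calc (2 * ((d : ℝ) + 1) * L) * ((L : ℝ) ^ j * M) = 2 * ((d : ℝ) + 1) * (L : ℝ) ^ (j + 1) * M := by ring
        _ < Real.log 2 := hrad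
    funext z κ
    rw [logIter_succ, logIter_eq_linCovIter_one hB hL hM0 hM j hrad', linCovIter_one_succ_of_commute hB hL,
      mlog_dbavg_expCfg_of_norm_le (commute_linCovIter_one hB hL j) hL (by positivity)
        (norm_linCovIter_one_le hB hL hM0 hM j) hradj]

/-- **THE REMAINDER (150)∕(134) VANISHES ON ABELIAN FIELDS AT THE FLAT BACKGROUND**: `C_j(1, B)(c) = 0` for every bond `c` of level `j`,
when `2(d+1)·Lʲ·sup‖B‖ < ln 2`. [cite: Balaban1985Averaging, (134) p.38, (150) p.40] -/
theorem CCovIter_one_eq_zero {B : Site d → Fin d → 𝔸} (hB : ∀ x κ y μ, Commute (B x κ) (B y μ)) (hL : 1 ≤ L) {M : ℝ}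
    (hM0 : 0 ≤ M) (hM : ∀ x κ, ‖B x κ‖ ≤ M) (j : ℕ) (hrad : 2 * ((d : ℝ) + 1) * (L : ℝ) ^ j * M < Real.log 2)
    (z : Site d) (κ : Fin d) :
    CCovIter L (1 : Site d → Fin d → 𝔸ˣ) B j z κ = 0 := by
  show logCovIter L (1 : Site d → Fin d → 𝔸ˣ) B j z κ - linCovIter L (1 : Site d → Fin d → 𝔸ˣ) B j z κ = 0
  rw [logCovIter_one_left, logIter_eq_linCovIter_one hB hL hM0 hM j hrad, sub_self]

/-! ## §4 Every homogeneous term of (136) vanishes on abelian fields at the flat background -/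

/-- Along the abelian ray `t ↦ tB` the remainder `C_j(1, tB)(c)` is IDENTICALLY ZERO for `t` near `0`. [cite: Balaban1985Averaging, (136)–(137) p.39] -/
theorem eventually_CCovIter_one_smul_eq_zero {B : Site d → Fin d → 𝔸} (hB : ∀ x κ y μ, Commute (B x κ) (B y μ))
    (hL : 1 ≤ L) {M : ℝ} (hM0 : 0 ≤ M) (hM : ∀ x κ, ‖B x κ‖ ≤ M) (j : ℕ) (z : Site d) (κ : Fin d) :
    ∀ᶠ t : ℂ in 𝓝 0, CCovIter L (1 : Site d → Fin d → 𝔸ˣ) (t • B) j z κ = 0 := by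
  have h2 : (0 : ℝ) < Real.log 2 := Real.log_pos one_lt_two
  have hc : Continuous fun t : ℂ => 2 * ((d : ℝ) + 1) * (L : ℝ) ^ j * (‖t‖ * M) := by fun_prop
  have hev : ∀ᶠ t : ℂ in 𝓝 0, 2 * ((d : ℝ) + 1) * (L : ℝ) ^ j * (‖t‖ * M) < Real.log 2 :=
    (isOpen_lt hc continuous_const).mem_nhds (by simpa using h2)
  refine hev.mono fun t ht => ?_
  exact CCovIter_one_eq_zero (commute_smul hB t) hL (by positivity)
    (fun x κ => by rw [Pi.smul_apply, Pi.smul_apply, norm_smul]; exact mul_le_mul_of_nonneg_left (hM x κ) (norm_nonneg _))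
    j ht z κ

/-- **NO DIAGONAL CURVATURE OF THE COMPOSED AVERAGING: `C_j⁽²⁾(1, B)(c) = 0`** — the second-order term of (136) vanishes on every abelian
(in particular every one-parameter) field at the flat background, at every level `j` and bond `c`. [cite: Balaban1985Averaging, (136) p.39]
[cite: Balaban1985BackgroundPropagators, (3.127) p.421] -/
theorem CCovIter2_one_eq_zero {B : Site d → Fin d → 𝔸} (hB : ∀ x κ y μ, Commute (B x κ) (B y μ)) (hL : 1 ≤ L) {M : ℝ}
    (hM0 : 0 ≤ M) (hM : ∀ x κ, ‖B x κ‖ ≤ M) (j : ℕ) (z : Site d) (κ : Fin d) :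
    CCovIter2 L (1 : Site d → Fin d → 𝔸ˣ) B j z κ = 0 := by
  have hev : (fun t : ℂ => CCovIter L (1 : Site d → Fin d → 𝔸ˣ) (t • B) j z κ) =ᶠ[𝓝 0] fun _ => (0 : 𝔸) :=
    eventually_CCovIter_one_smul_eq_zero hB hL hM0 hM j z κ
  rw [CCovIter2_def, hev.iteratedDeriv_eq, iteratedDeriv_const]
  simp

/-- **EVERY HOMOGENEOUS TERM OF (136) VANISHES: `C_j⁽ⁿ⁾(1, B)(c) = 0` for all `n`** (abelian field, flat background). [cite: Balaban1985Averaging, (136) p.39] -/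
theorem CCovIterN_one_eq_zero {B : Site d → Fin d → 𝔸} (hB : ∀ x κ y μ, Commute (B x κ) (B y μ)) (hL : 1 ≤ L) {M : ℝ}
    (hM0 : 0 ≤ M) (hM : ∀ x κ, ‖B x κ‖ ≤ M) (j : ℕ) (z : Site d) (κ : Fin d) (n : ℕ) :
    CCovIterN L (1 : Site d → Fin d → 𝔸ˣ) B j z κ n = 0 := by
  have hev : (fun t : ℂ => CCovIter L (1 : Site d → Fin d → 𝔸ˣ) (t • B) j z κ) =ᶠ[𝓝 0] fun _ => (0 : 𝔸) :=
    eventually_CCovIter_one_smul_eq_zero hB hL hM0 hM j z κ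
  rw [CCovIterN_def, hev.iteratedDeriv_eq, iteratedDeriv_const]
  simp

/-- One-parameter form (NE1.md R46's slot model): for `B_b = s_b·C` with bounded complex amplitudes, every `C_j⁽ⁿ⁾(1, B)(c)` vanishes —
the composed averaging has NO diagonal term of any order `n ≥ 2` in the direction of a one-parameter slot. [cite: Balaban1985Averaging, (136) p.39] -/
theorem CCovIterN_one_oneParameter_eq_zero (hL : 1 ≤ L) (s : Site d → Fin d → ℂ) (C : 𝔸) {m : ℝ} (hm0 : 0 ≤ m)
    (hm : ∀ x κ, ‖s x κ‖ ≤ m) (j : ℕ) (z : Site d) (κ : Fin d) (n : ℕ) :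
    CCovIterN L (1 : Site d → Fin d → 𝔸ˣ) (fun y μ => s y μ • C) j z κ n = 0 :=
  CCovIterN_one_eq_zero (fun x κ y μ => ((Commute.refl C).smul_left _).smul_right _) hL (by positivity : 0 ≤ m * ‖C‖)
    (fun x κ => by rw [norm_smul]; exact mul_le_mul_of_nonneg_right (hm x κ) (norm_nonneg _)) j z κ n

/-- **NO SINGLE-BOND TERM OF ANY ORDER IN (136) AT THE FLAT BACKGROUND**: for EVERY `X ∈ 𝔸` (not only a one-parameter direction) the
single-bond field `Xδ_b` (`B7Prop5Flat.bump`) has `C_j⁽ⁿ⁾(1, Xδ_b)(c) = 0` for all `n`, since its values `{X, 0}` commute. [cite: Balaban1985Averaging, (136)–(137) p.39] -/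
theorem CCovIterN_one_bump_eq_zero (hL : 1 ≤ L) (y : Site d) (μ : Fin d) (X : 𝔸) (j : ℕ) (z : Site d) (κ : Fin d) (n : ℕ) :
    CCovIterN L (1 : Site d → Fin d → 𝔸ˣ) (bump y μ X) j z κ n = 0 := by
  refine CCovIterN_one_eq_zero (fun x κ x' κ' => ?_) hL (norm_nonneg X) (fun x κ => norm_bump_le y μ X x κ) j z κ n
  unfold bump; split_ifs <;> simp

/-- **THE TWO-BOND TERMS OF (136) VANISH ON COMMUTING PAIRS**: `C_j⁽ⁿ⁾(1, Xδ_b + Yδ_{b′})(c) = 0` for all `n` whenever `XY = YX` — the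
homogeneous terms of Bałaban's remainder at the flat background see a pair of excited bonds only through the NON-COMMUTATIVITY of the pair
(for `M_N(ℂ)` a bilinear map vanishing on commuting pairs factors through the commutator — Brešar–Grašič–Sánchez Ortega's «zero Lie product
determined» property, LAA 430 (2009) ∕ Brešar 2021 Cor. 3.11, NOT formalised here). [cite: Balaban1985Averaging, (136)–(137) p.39] -/
theorem CCovIterN_one_twoBumps_eq_zero (hL : 1 ≤ L) (y : Site d) (μ : Fin d) (y' : Site d) (μ' : Fin d) {X Y : 𝔸}
    (hXY : Commute X Y) (j : ℕ) (z : Site d) (κ : Fin d) (n : ℕ) :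
    CCovIterN L (1 : Site d → Fin d → 𝔸ˣ) (bump y μ X + bump y' μ' Y) j z κ n = 0 := by
  have hval : ∀ x κ, Commute (bump y μ X x κ) X ∧ Commute (bump y μ X x κ) Y ∧
      Commute (bump y' μ' Y x κ) X ∧ Commute (bump y' μ' Y x κ) Y := fun x κ => by
    unfold bump
    refine ⟨?_, ?_, ?_, ?_⟩ <;> split_ifs <;> first | exact Commute.refl _ | exact Commute.zero_left _ | exact hXY | exact hXY.symm
  refine CCovIterN_one_eq_zero (fun x κ x' κ' => ?_) hL (by positivity : (0 : ℝ) ≤ ‖X‖ + ‖Y‖) (fun x κ => ?_) j z κ n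
  · have h1 : ∀ x κ, Commute ((bump y μ X + bump y' μ' Y) x κ) X := fun x κ => (hval x κ).1.add_left (hval x κ).2.2.1
    have h2 : ∀ x κ, Commute ((bump y μ X + bump y' μ' Y) x κ) Y := fun x κ => (hval x κ).2.1.add_left (hval x κ).2.2.2
    have hb : ∀ x κ (Z : 𝔸), Commute Z X → Commute Z Y → Commute Z ((bump y μ X + bump y' μ' Y) x κ) := fun x κ Z hX hY => by
      rw [Pi.add_apply, Pi.add_apply]
      refine Commute.add_right ?_ ?_ <;> · unfold bump; split_ifs; exacts [by assumption, Commute.zero_right _]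
    exact hb x' κ' _ (h1 x κ) (h2 x κ)
  · rw [Pi.add_apply, Pi.add_apply]
    exact (norm_add_le _ _).trans (add_le_add (norm_bump_le y μ X x κ) (norm_bump_le y' μ' Y x κ))

end Summit.QuantumFields.BalabanUV.T4Continuum.NE1p.B7AveragingAbelianSector

end
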